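import Summits.ResolutionOfSingularities.ResolutionOfSingularities.Theorems.MarkedTransferCampaignW46ThreefoldsGammaFreeGlobalSNCEnd
import Literature.AlgebraicGeometry.Resolution.MonomialMarkedIdeals
import Literature.AlgebraicGeometry.Resolution.RsopMonomialIdeals
import Literature.AlgebraicGeometry.Resolution.AlterationsBoundaryDivisor
import Literature.AlgebraicGeometry.Resolution.BlowupsProduct
import HarnessLib

/-!
# [OURS · L1 W4.6 rung (i), host words] THE HOST BOUNDARY `E` INSIDE THE PRIME DIVISORS OF `J = I·∏E`
# (germs of snc boundary members are germs of prime divisors of `J`; snc members are effective Cartier)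

Cell res-hironaka, LADDER-RESOLUTION rung L (D-0089), slot W4.6, rung (i) SURFACES in the HOST ITEM'S OWN WORDS: the
surface rung `CampaignW46.HypersurfaceOrderReductionDimLE p 2` of res-L1-type-o1's host ladder (`…W46HostLadder.lean`:
the text of MarkedTransfer `HypersurfaceOrderReductionDimLeThree` stmt-ResolutionOfSingularities-16156 with `3 ↦ d`).
Seat res-L1-s46-pv-1 (gen 6). This file is the POINTWISE TOOLKIT of the surface rung; proposed `--kind proof --supports`
stmt-16156 `--as helper`. Everything here is OURS scheme theory over the tree's blow-up / snc library and res-D-pv-049 AS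
res-L1-s46-pv-11's rung (ii-2) bricks; nothing of H. Hironaka's manuscript [Hironaka2017] is asserted. AI-written; AI review
is weaker than expert review.

## What is proved (no definitions)

* `CampaignW46.exists_branch_stalkIdeal_eq_of_le` — **THE HOST BOUNDARY SITS INSIDE THE PRIME DIVISORS OF `J`**: if
  `J ≤ D` (`D` a member of an snc boundary, `J ≠ 0` locally principal on a regular integral Noetherian scheme) and
  `y ∈ Supp D`, some codimension-one point `ζ` of `V(J)` on `Supp D` specialises to `y` with `(𝓘_{cl ζ})_y = D_y` (the germ
  `D_y = (w)` is a prime dividing `J_y = ∏ 𝔭_ζ^{a_ζ}`, Cossart–Piltant's divisorial decomposition; ring helper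
  `exists_mem_le_of_list_prod_le`). This is how the surface rung reads the host boundary `E` on the single effective Cartier
  ideal `J = I · ∏_{D ∈ E} D` whose prime-divisor family carries res-L1-s46-pv-11's measure.
* `CampaignW46.HasSNC.isEffectiveCartier_of_mem` / `HasSNC.ne_bot_of_mem` / `HasSNC.isEffectiveCartier_prod` — members (and
  the product) of an snc boundary on an integral locally Noetherian scheme are non-zero effective Cartier divisors.

## Sources

* E. Bierstone, D. Grigoriev, P. Milman, J. Włodarczyk, arXiv:1206.3090, Def. 3.1.1, Def. 3.1.3 (2).
  [BierstoneGrigorievMilmanWlodarczyk2011]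
* V. Cossart, O. Piltant, J. Algebra 320 (2008), proof of Prop. 4.2 (divisorial decomposition). [CossartPiltant2008]
* U. Görtz, T. Wedhorn, *Algebraic Geometry I* (2020), Thm. 11.40 (2). [GortzWedhorn2020]
* H. Matsumura, *Commutative Ring Theory* (1986), Thm. 14.2, Thm. 20.3. [Matsumura1987]
* H. Hironaka, ms. 2017-03-23 — scope only, under adjudication, not cited as fact. [Hironaka2017]
-/

noncomputable section

set_option linter.dupNamespace false -- mandated namespace of this single-conjunct summit

open CategoryTheory AlgebraicGeometry TopologicalSpace IsLocalRing

namespace Summit.ResolutionOfSingularities.ResolutionOfSingularities.Theorems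

namespace CampaignW46

open Literature.AlgebraicGeometry.Resolution
open Scheme.IdealSheafData

universe u

variable {X : Scheme.{u}}

/-! ## §1 The host boundary inside the prime divisors of `J` -/

/-- In a list product of ideals contained in a prime, some factor is contained in the prime. [folklore] -/
theorem exists_mem_le_of_list_prod_le {R : Type*} [CommSemiring R] {P : Ideal R} (hP : P.IsPrime) :
    ∀ (l : List (Ideal R)), l.prod ≤ P → ∃ A ∈ l, A ≤ P
  | [], h => by
    rw [List.prod_nil, Ideal.one_eq_top, top_le_iff] at h
    exact absurd h hP.ne_top
  | A :: l, h => by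
    rw [List.prod_cons] at h
    rcases hP.mul_le.mp h with hA | hl
    · exact ⟨A, List.mem_cons_self .., hA⟩
    · obtain ⟨B, hB, hBP⟩ := exists_mem_le_of_list_prod_le hP l hl
      exact ⟨B, List.mem_cons_of_mem _ hB, hBP⟩

/-- **The host boundary sits inside the prime divisors of `J`.** `X` regular integral Noetherian, `E` an snc boundary,
`J ≠ 0` locally principal with `J ≤ D` for the member `D ∈ E`, and `x ∈ Supp D`: some codimension-one point `ζ` of `V(J)`
specialises to `x`, lies on `Supp D`, and has `(𝓘_{cl ζ})_x = D_x` (the germ `D_x = (w)` is a prime dividing the product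
`J_x = ∏ 𝔭_ζ^{a_ζ}` of the prime divisors of `J`, Cossart–Piltant's divisorial decomposition). [cite: CossartPiltant2008, proof of Prop. 4.2] -/
theorem exists_branch_stalkIdeal_eq_of_le [IsIntegral X] [IsNoetherian X] (hX : Scheme.IsRegular X)
    {E : List X.IdealSheafData} (hE : HasSNC E) {J : X.IdealSheafData} (hJ : J ≠ ⊥) (hJp : IsLocallyPrincipal J)
    {D : X.IdealSheafData} (hD : D ∈ E) (hJD : J ≤ D) {x : X} (hx : x ∈ D.support) :
    ∃ ζ ∈ divisorialPoints J, ζ ⤳ x ∧ ζ ∈ D.support ∧ stalkIdeal (primeDivisorIdeal ζ) x = stalkIdeal D x := by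
  classical
  obtain ⟨hreg, u, hu, ⟨ι, -, hι⟩, -⟩ := hE x
  haveI := hreg
  haveI : IsDomain (X.presheaf.stalk x) := isDomain_of_isRegularLocalRing _
  have hrsop : IsRsopPart (u ∘ id) := isRsopPart_comp_of_rsop rfl u hu id Function.injective_id
  set w := u (ι ⟨D, hD, hx⟩) with hw
  have hwprime : Prime w := by simpa [Function.comp] using hrsop.prime (ι ⟨D, hD, hx⟩)
  have hDx : stalkIdeal D x = Ideal.span {w} := hι ⟨D, hD, hx⟩
  have hPrime : (Ideal.span ({w} : Set (X.presheaf.stalk x))).IsPrime :=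
    (Ideal.span_singleton_prime hwprime.ne_zero).mpr hwprime
  -- `J_x = ∏ 𝔭_ζ^{a_ζ} ≤ (w)`
  have hJx : stalkIdeal J x ≤ Ideal.span {w} := hDx ▸ stalkIdeal_mono hJD x
  rw [eq_monomialIdeal_divisorial hX hJ hJp, stalkIdeal_monomialIdeal, List.map_map] at hJx
  obtain ⟨A, hA, hAw⟩ := exists_mem_le_of_list_prod_le hPrime _ hJx
  obtain ⟨ζ, hζmem, rfl⟩ := List.mem_map.mp hA
  have hζ : ζ ∈ divisorialPoints J := by simpa using hζmem
  -- the factor `𝔭_ζ^{a_ζ} ≤ (w)` forces `𝔭_ζ ≤ (w)`, so `ζ ⤳ x`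
  have hle : stalkIdeal (primeDivisorIdeal ζ) x ≤ Ideal.span {w} := by
    have h := hAw
    simp only [Function.comp] at h
    by_cases ha : (idealOrder J ζ).toNat = 0
    · rw [ha, pow_zero, Ideal.one_eq_top, top_le_iff] at h
      exact absurd h hPrime.ne_top
    · exact (Ideal.IsPrime.pow_le_iff ha).mp h
  have hsp : ζ ⤳ x := by
    by_contra hns
    rw [stalkIdeal_primeDivisorIdeal_eq_top hns, top_le_iff] at hle
    exact hPrime.ne_top hle
  obtain ⟨q, hq, hqeq⟩ := exists_stalkIdeal_primeDivisorIdeal_eq_span hX.uniqueFactorizationMonoid_stalk hsp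
    ((mem_divisorialPoints_iff J ζ).mp hζ).2
  have heq : stalkIdeal (primeDivisorIdeal ζ) x = stalkIdeal D x := by
    rw [hqeq, hDx]
    rw [hqeq, Ideal.span_singleton_le_span_singleton] at hle
    exact Ideal.span_singleton_eq_span_singleton.mpr (hwprime.irreducible.associated_of_dvd hq.irreducible hle).symm
  refine ⟨ζ, hζ, hsp, ?_, heq⟩
  -- `ζ ∈ Supp D`: `D_ζ = D_x 𝒪_ζ = 𝔭_ζ 𝒪_ζ = 𝔪_ζ`
  rw [mem_support_iff_stalkIdeal_le, ← stalkIdeal_map_stalkSpecializes D hsp, ← heq, stalkIdeal_map_stalkSpecializes,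
    stalkIdeal_primeDivisorIdeal_self]

/-! ## §2 Members of an snc boundary are effective Cartier divisors -/

/-- **A member of an snc boundary on an integral locally Noetherian scheme is an effective Cartier divisor** (its germs
are generated by non-zero coordinates of regular systems of parameters). [cite: GortzWedhorn2020, Thm. 11.40 (2)] -/
theorem HasSNC.isEffectiveCartier_of_mem [IsIntegral X] [IsLocallyNoetherian X] {E : List X.IdealSheafData}
    (hE : HasSNC E) {D : X.IdealSheafData} (hD : D ∈ E) : IsEffectiveCartier D := by
  refine isEffectiveCartier_of_stalkIdeal_eq_span_singleton fun x hx => ?_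
  obtain ⟨hreg, u, hu, ⟨ι, -, hι⟩, -⟩ := hE x
  haveI := hreg
  have hrsop : IsRsopPart (u ∘ id) := isRsopPart_comp_of_rsop rfl u hu id Function.injective_id
  exact ⟨u (ι ⟨D, hD, hx⟩), by simpa [Function.comp] using hrsop.ne_zero (ι ⟨D, hD, hx⟩), hι ⟨D, hD, hx⟩⟩

/-- A member of an snc boundary on an integral locally Noetherian scheme is not the zero ideal sheaf. [folklore] -/
theorem HasSNC.ne_bot_of_mem [IsIntegral X] [IsLocallyNoetherian X] {E : List X.IdealSheafData}
    (hE : HasSNC E) {D : X.IdealSheafData} (hD : D ∈ E) : D ≠ ⊥ := by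
  intro h0
  obtain ⟨U, hxU, g, hg, hU⟩ := HasSNC.isEffectiveCartier_of_mem hE hD (genericPoint X)
  rw [h0, Scheme.IdealSheafData.ideal_bot, Pi.bot_apply, eq_comm, Ideal.span_singleton_eq_bot] at hU
  subst hU
  haveI : Nonempty (U : X.Opens) := ⟨⟨_, hxU⟩⟩
  exact zero_notMem_nonZeroDivisors hg

/-- The product of an snc boundary (as ideal sheaves) on an integral locally Noetherian scheme is an effective Cartier
divisor. [folklore] -/
theorem HasSNC.isEffectiveCartier_prod [IsIntegral X] [IsLocallyNoetherian X] {E : List X.IdealSheafData}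
    (hE : HasSNC E) : IsEffectiveCartier E.prod := by
  suffices h : ∀ F : List X.IdealSheafData, (∀ D ∈ F, D ∈ E) → IsEffectiveCartier F.prod from h E fun D hD => hD
  intro F hF
  induction F with
  | nil => rw [List.prod_nil, Scheme.IdealSheafData.one_eq_top]; exact isEffectiveCartier_top
  | cons D F ih =>
    rw [List.prod_cons]
    exact (HasSNC.isEffectiveCartier_of_mem hE (hF D (List.mem_cons_self ..))).mul
      (ih fun D' hD' => hF D' (List.mem_cons_of_mem _ hD'))

end CampaignW46

end Summit.ResolutionOfSingularities.ResolutionOfSingularities.Theorems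

end
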